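import Summits.CriticalPhenomena.PercolationContinuityZ3.Theorems.Transplant.FKConnectivityAllQAntipodalX2SpineRows
import Summits.CriticalPhenomena.PercolationContinuityZ3.Theorems.Transplant.FKConnectivityAllQAntipodalX2SpineExtract
import HarnessLib

/-!
# Connectivity correlation inequalities for `φ_{w,q}` — the spine of a marked edge, file 8: FIBRE SUMS — the recursion over the parts
# and ONE APPLICATION OF THEOREM U PER FLIPPED PART ((S3) of memo g13 §7.3)

Helper file (`--supports stmt-CriticalPhenomena-4575`), FK sub-lane `prim-bschramm-fk-2` (gen 14); builds on p205010 (kernel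
theorem, internal audit signed; external expert review pending).  No definitions, no named facts, no sorries; standard axioms.

`fiberSum q ps T g w = ∑_{B ⊆ T : word(B) = w} q^{expSum B} g(B)` (file `…X2SpineDefs`).
* `FK.fiberSum_cons` — peeling the innermost part `p` (ambient set `P₀ = T ∩ R_p`, the rest `T' = T ∖ R_p`):
  `fiberSum (p :: ps) T g (l :: w) = ∑_{X ⊆ P₀ : letter(X) = l} q^{apExp P₀ X} · fiberSum ps T' g(X ∪ ·) w`;
* `FK.apUpc_eq_filter_sub` — Theorem U's functional `apUpc q P₀ x y h` is the `10`-fibre minus the `01`-fibre of `h`;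
* **`FK.fiberSum_le_of_flip`** — for `g` monotone on the subsets of `T`, every part two-terminal series–parallel between its terminals,
  and words `w ≤ w'` related letterwise by flips `01 → 10` (the relation delivered by `FK.X2Word.sigma_wordHall`):
  `fiberSum w ≤ fiberSum w'` — induction over the parts; a flipped part contributes `apUpc q P₀ x y h ≥ 0` for the monotone section
  `h(X) = fiberSum ps T' g(X ∪ ·) w'` (Theorem U, `FK.apUpc_nonneg_of_isTTSP`, every `q > 0`), an unflipped part a termwise comparison.
[cite: Grimmett2006, §3.8 Thm. (3.90) (pp. 61–62); §3.9 (p. 63)]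
-/

noncomputable section

namespace Summit.CriticalPhenomena.PercolationContinuityZ3.Theorems

namespace FK

open SimpleGraph Literature.Probability.LatticeModels Literature.Probability.Percolation X2Word
open scoped Classical

variable {V : Type*}

/-! ### Restriction to the outer parts; peeling the innermost part -/

/-- The word and the exponent along `ps` only read the traces of `ω`, `T ∖ ω` and `T` on the parts. [folklore] -/
theorem spineWord_expSum_congr (ps : List (SpinePart V)) {T T' ω ω' : Finset (Sym2 V)}
    (h : ∀ p ∈ ps, ω ∩ p.R = ω' ∩ p.R ∧ (T \ ω) ∩ p.R = (T' \ ω') ∩ p.R ∧ T ∩ p.R = T' ∩ p.R) :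
    spineWord ps T ω = spineWord ps T' ω' ∧ expSum ps T ω = expSum ps T' ω' := by
  induction ps with
  | nil => exact ⟨rfl, rfl⟩
  | cons p ps ih =>
    obtain ⟨h1, h2, h3⟩ := h p List.mem_cons_self
    obtain ⟨ihw, ihe⟩ := ih fun p' hp' => h p' (List.mem_cons_of_mem _ hp')
    refine ⟨?_, ?_⟩
    · rw [spineWord_cons, spineWord_cons, ihw]
      simp only [SpinePart.letter, SpinePart.bit, h1, h2]
    · rw [expSum_cons, expSum_cons, ihe, h3, h1]

/-- **Traces of a split configuration** `X ∪ Y` (`X` inside the innermost part, `Y` in the outer parts). [folklore] -/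
theorem traces_union {p : SpinePart V} {ps : List (SpinePart V)} {T X Y : Finset (Sym2 V)}
    (hd : ∀ p' ∈ ps, Disjoint p.R p'.R) (hX : X ⊆ T ∩ p.R) (hY : Y ⊆ T \ p.R) :
    ((X ∪ Y) ∩ p.R = X ∩ p.R ∧ (T \ (X ∪ Y)) ∩ p.R = ((T ∩ p.R) \ X) ∩ p.R) ∧
      ∀ p' ∈ ps, (X ∪ Y) ∩ p'.R = Y ∩ p'.R ∧ (T \ (X ∪ Y)) ∩ p'.R = ((T \ p.R) \ Y) ∩ p'.R ∧ T ∩ p'.R = (T \ p.R) ∩ p'.R := by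
  have hXR : ∀ e ∈ X, e ∈ p.R := fun e he => (Finset.mem_inter.1 (hX he)).2
  have hYR : ∀ e ∈ Y, e ∉ p.R := fun e he => (Finset.mem_sdiff.1 (hY he)).2
  refine ⟨⟨?_, ?_⟩, fun p' hp' => ⟨?_, ?_, ?_⟩⟩
  · ext e
    simp only [Finset.mem_inter, Finset.mem_union]
    constructor
    · rintro ⟨he | he, heR⟩
      · exact ⟨he, heR⟩
      · exact absurd heR (hYR e he)
    · rintro ⟨he, heR⟩; exact ⟨Or.inl he, heR⟩
  · ext e
    simp only [Finset.mem_inter, Finset.mem_sdiff, Finset.mem_union, not_or]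
    constructor
    · rintro ⟨⟨heT, heX, -⟩, heR⟩; exact ⟨⟨⟨heT, heR⟩, heX⟩, heR⟩
    · rintro ⟨⟨⟨heT, -⟩, heX⟩, heR⟩; exact ⟨⟨heT, heX, fun heY => hYR e heY heR⟩, heR⟩
  · ext e
    simp only [Finset.mem_inter, Finset.mem_union]
    constructor
    · rintro ⟨he | he, heR⟩
      · exact absurd heR (Finset.disjoint_left.1 (hd p' hp') (hXR e he))
      · exact ⟨he, heR⟩
    · rintro ⟨he, heR⟩; exact ⟨Or.inr he, heR⟩
  · ext e
    simp only [Finset.mem_inter, Finset.mem_sdiff, Finset.mem_union, not_or]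
    constructor
    · rintro ⟨⟨heT, -, heY⟩, heR⟩
      exact ⟨⟨⟨heT, fun h => Finset.disjoint_left.1 (hd p' hp') h heR⟩, heY⟩, heR⟩
    · rintro ⟨⟨⟨heT, heR0⟩, heY⟩, heR⟩
      exact ⟨⟨heT, fun h => heR0 (hXR e h), heY⟩, heR⟩
  · ext e
    simp only [Finset.mem_inter, Finset.mem_sdiff]
    constructor
    · rintro ⟨heT, heR⟩; exact ⟨⟨heT, fun h => Finset.disjoint_left.1 (hd p' hp') h heR⟩, heR⟩
    · rintro ⟨⟨heT, -⟩, heR⟩; exact ⟨heT, heR⟩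

/-- **Word and exponent of a split configuration**: the innermost letter and exponent are those of `X` inside `P₀ = T ∩ R_p`, the rest
those of `Y` inside `T ∖ R_p`. [folklore] -/
theorem spineWord_expSum_union {p : SpinePart V} {ps : List (SpinePart V)} {T X Y : Finset (Sym2 V)}
    (hd : ∀ p' ∈ ps, Disjoint p.R p'.R) (hX : X ⊆ T ∩ p.R) (hY : Y ⊆ T \ p.R) :
    spineWord (p :: ps) T (X ∪ Y) = p.letter (T ∩ p.R) X :: spineWord ps (T \ p.R) Y ∧
      expSum (p :: ps) T (X ∪ Y) = apExp (T ∩ p.R) X + expSum ps (T \ p.R) Y := by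
  obtain ⟨⟨h1, h2⟩, hrest⟩ := traces_union hd hX hY
  obtain ⟨hw, he⟩ := spineWord_expSum_congr ps hrest
  have hXeq : (X ∪ Y) ∩ p.R = X := by
    rw [h1]; exact Finset.inter_eq_left.2 fun e he => (Finset.mem_inter.1 (hX he)).2
  refine ⟨?_, ?_⟩
  · rw [spineWord_cons, hw]
    simp only [SpinePart.letter, SpinePart.bit, h1, h2]
  · rw [expSum_cons, he, hXeq]

/-- The fibre sum as a sum with an indicator. [folklore] -/
theorem fiberSum_eq_ite (q : ℝ) (ps : List (SpinePart V)) (T : Finset (Sym2 V)) (g : Finset (Sym2 V) → ℝ) (w : List SLetter) :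
    fiberSum q ps T g w = ∑ B ∈ T.powerset, if spineWord ps T B = w then q ^ expSum ps T B * g B else 0 := by
  unfold fiberSum; rw [Finset.sum_filter]

/-- **Peeling the innermost part**: `fiberSum (p :: ps) T g (l :: w) = ∑_{X ⊆ P₀ : letter(X) = l} q^{apExp P₀ X} · fiberSum ps (T ∖ R_p) g(X ∪ ·) w`.
[folklore] -/
theorem fiberSum_cons (q : ℝ) {p : SpinePart V} {ps : List (SpinePart V)} (hd : ∀ p' ∈ ps, Disjoint p.R p'.R)
    (T : Finset (Sym2 V)) (g : Finset (Sym2 V) → ℝ) (l : SLetter) (w : List SLetter) :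
    fiberSum q (p :: ps) T g (l :: w) =
      ∑ X ∈ (T ∩ p.R).powerset.filter (fun X => p.letter (T ∩ p.R) X = l),
        q ^ apExp (T ∩ p.R) X * fiberSum q ps (T \ p.R) (fun Y => g (X ∪ Y)) w := by
  rw [fiberSum_eq_ite, Finset.sum_filter]
  have key : ∑ B ∈ (T \ p.R ∪ T ∩ p.R).powerset,
      (if spineWord (p :: ps) T B = l :: w then q ^ expSum (p :: ps) T B * g B else 0) =
      ∑ X ∈ (T ∩ p.R).powerset, if p.letter (T ∩ p.R) X = l then
        q ^ apExp (T ∩ p.R) X * fiberSum q ps (T \ p.R) (fun Y => g (X ∪ Y)) w else 0 := by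
    rw [sum_powerset_union_disj (Finset.disjoint_sdiff_inter T p.R), Finset.sum_comm]
    refine Finset.sum_congr rfl fun X hX => ?_
    rw [Finset.mem_powerset] at hX
    rw [fiberSum_eq_ite, Finset.mul_sum]
    rw [show (if p.letter (T ∩ p.R) X = l then
        ∑ Y ∈ (T \ p.R).powerset, q ^ apExp (T ∩ p.R) X *
          (if spineWord ps (T \ p.R) Y = w then q ^ expSum ps (T \ p.R) Y * g (X ∪ Y) else 0) else 0) =
        ∑ Y ∈ (T \ p.R).powerset, if p.letter (T ∩ p.R) X = l then q ^ apExp (T ∩ p.R) X *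
          (if spineWord ps (T \ p.R) Y = w then q ^ expSum ps (T \ p.R) Y * g (X ∪ Y) else 0) else 0 by
      split_ifs <;> simp]
    refine Finset.sum_congr rfl fun Y hY => ?_
    rw [Finset.mem_powerset] at hY
    obtain ⟨hw, he⟩ := spineWord_expSum_union hd hX hY
    rw [Finset.union_comm, hw, he, pow_add]
    by_cases hl : p.letter (T ∩ p.R) X = l
    · by_cases hw' : spineWord ps (T \ p.R) Y = w
      · rw [if_pos (List.cons_eq_cons.2 ⟨hl, hw'⟩), if_pos hl, if_pos hw']; ring
      · rw [if_neg (fun h => hw' (List.cons_eq_cons.1 h).2), if_pos hl, if_neg hw', mul_zero]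
    · rw [if_neg (fun h => hl (List.cons_eq_cons.1 h).1), if_neg hl]
  rwa [Finset.sdiff_union_inter] at key

/-! ### Monotonicity in the test function; Theorem U's functional as a difference of two fibres -/

/-- The fibre sum is monotone in the test function (`q ≥ 0`). [folklore] -/
theorem fiberSum_mono {q : ℝ} (hq : 0 ≤ q) (ps : List (SpinePart V)) {T : Finset (Sym2 V)} {g g' : Finset (Sym2 V) → ℝ}
    (hgg' : ∀ B ⊆ T, g B ≤ g' B) (w : List SLetter) : fiberSum q ps T g w ≤ fiberSum q ps T g' w := by
  unfold fiberSum
  refine Finset.sum_le_sum fun B hB => ?_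
  have hBT : B ⊆ T := Finset.mem_powerset.1 (Finset.mem_filter.1 hB).1
  exact mul_le_mul_of_nonneg_left (hgg' B hBT) (pow_nonneg hq _)

/-- The fibre sum of a nonnegative test function is nonnegative (`q ≥ 0`). [folklore] -/
theorem fiberSum_nonneg {q : ℝ} (hq : 0 ≤ q) (ps : List (SpinePart V)) {T : Finset (Sym2 V)} {g : Finset (Sym2 V) → ℝ}
    (hg : ∀ B ⊆ T, 0 ≤ g B) (w : List SLetter) : 0 ≤ fiberSum q ps T g w := by
  unfold fiberSum
  refine Finset.sum_nonneg fun B hB => ?_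
  have hBT : B ⊆ T := Finset.mem_powerset.1 (Finset.mem_filter.1 hB).1
  exact mul_nonneg (pow_nonneg hq _) (hg B hBT)

/-- The letter of `X` inside `P` as a pair of conditions on the bits. [folklore] -/
theorem SpinePart.letter_eq_iff (p : SpinePart V) (P X : Finset (Sym2 V)) (b bb : Bool) :
    p.letter P X = (p.kind, b, bb) ↔ p.bit X = b ∧ p.bit (P \ X) = bb := by
  unfold SpinePart.letter
  simp only [Prod.mk.injEq, true_and]

/-- The bit of a configuration inside the part reads the connection of the configuration itself. [folklore] -/
theorem SpinePart.bit_eq_true_of_subset (p : SpinePart V) {X : Finset (Sym2 V)} (hX : X ⊆ p.R) :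
    p.bit X = true ↔ (openGraph (↑X : BondConfig V)).Reachable p.x p.y := by
  unfold SpinePart.bit
  rw [decide_eq_true_iff, Finset.inter_eq_left.2 hX]

/-- **Theorem U's functional is the `10`-fibre minus the `01`-fibre**: for `P ⊆ R_p`,
`apUpc q P x y h = ∑_{X ⊆ P : letter(X) = (k,1,0)} q^{apExp P X} h(X) - ∑_{X ⊆ P : letter(X) = (k,0,1)} q^{apExp P X} h(X)`
(the letters `00` and `11` carry the coefficient `0`). [folklore] -/
theorem apUpc_eq_filter_sub (q : ℝ) (p : SpinePart V) {P : Finset (Sym2 V)} (hP : P ⊆ p.R) (h : Finset (Sym2 V) → ℝ) :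
    apUpc q P p.x p.y h =
      (∑ X ∈ P.powerset.filter (fun X => p.letter P X = (p.kind, true, false)), q ^ apExp P X * h X) -
        ∑ X ∈ P.powerset.filter (fun X => p.letter P X = (p.kind, false, true)), q ^ apExp P X * h X := by
  unfold apUpc
  rw [Finset.sum_filter, Finset.sum_filter, ← Finset.sum_sub_distrib]
  refine Finset.sum_congr rfl fun X hX => ?_
  rw [Finset.mem_powerset] at hX
  have e1 := p.bit_eq_true_of_subset (hX.trans hP)
  have e2 := p.bit_eq_true_of_subset ((Finset.sdiff_subset (s := P) (t := X)).trans hP)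
  unfold SpinePart.letter
  by_cases r1 : (openGraph (↑X : BondConfig V)).Reachable p.x p.y <;>
  by_cases r2 : (openGraph (↑(P \ X) : BondConfig V)).Reachable p.x p.y
  · have b1 : p.bit X = true := e1.2 r1
    have b2 : p.bit (P \ X) = true := e2.2 r2
    rw [apConn_of_reachable r1, apConn_of_reachable r2, b1, b2]; simp
  · have b1 : p.bit X = true := e1.2 r1
    have b2 : p.bit (P \ X) = false := by simpa using (mt e2.1 r2)
    rw [apConn_of_reachable r1, apConn_of_not_reachable r2, b1, b2]; simp
  · have b1 : p.bit X = false := by simpa using (mt e1.1 r1)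
    have b2 : p.bit (P \ X) = true := e2.2 r2
    rw [apConn_of_not_reachable r1, apConn_of_reachable r2, b1, b2]; simp
  · have b1 : p.bit X = false := by simpa using (mt e1.1 r1)
    have b2 : p.bit (P \ X) = false := by simpa using (mt e2.1 r2)
    rw [apConn_of_not_reachable r1, apConn_of_not_reachable r2, b1, b2]; simp

/-! ### One application of Theorem U per flipped part -/

section Flip

variable [Fintype V]

/-- **(S3) of memo g13 §7.3 — termwise domination along a word-Hall flip.**  Let the parts of `ps` be pairwise edge-disjoint and each
two-terminal series–parallel between its terminals, `T` covered by the parts, `g` monotone on the subsets of `T`, `q > 0`.  If `w` is a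
word of the spine's shape and `w'` arises from `w` by flips `01 → 10` of some letters, then `fiberSum w ≤ fiberSum w'`: peeling the
innermost part, an unflipped letter compares the two sides termwise by induction, and a flipped letter adds
`apUpc q P₀ x y h ≥ 0` for the monotone section `h(X) = fiberSum ps (T ∖ R_p) g(X ∪ ·) w'` — Theorem U (`FK.apUpc_nonneg_of_isTTSP`).
[cite: Grimmett2006, §3.8 Thm. (3.90) (pp. 61–62); §3.9 (p. 63)] -/
theorem fiberSum_le_of_flip {q : ℝ} (hq : 0 < q) :
    ∀ (ps : List (SpinePart V)) (T : Finset (Sym2 V)) (g : Finset (Sym2 V) → ℝ) (w w' : List SLetter),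
      ps.Pairwise (fun p p' => Disjoint p.R p'.R) → (∀ p ∈ ps, IsTTSP p.R p.x p.y) → (∀ e ∈ T, ∃ p ∈ ps, e ∈ p.R) →
      (∀ ⦃A B : Finset (Sym2 V)⦄, A ⊆ B → B ⊆ T → g A ≤ g B) → w ∈ allWords ps →
      List.Forall₂ (fun a b : SLetter => b = a ∨ (a.2 = (false, true) ∧ b = (a.1, true, false))) w w' →
      fiberSum q ps T g w ≤ fiberSum q ps T g w' := by
  intro ps
  induction ps with
  | nil =>
    intro T g w w' _ _ _ _ hw hfl
    rw [allWords_nil, Finset.mem_singleton] at hw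
    subst hw
    cases hfl
    exact le_rfl
  | cons p ps ih =>
    intro T g w w' hpw hU hT hg hw hfl
    have hd : ∀ p' ∈ ps, Disjoint p.R p'.R := fun p' hp' => List.rel_of_pairwise_cons hpw hp'
    obtain ⟨b, bb, w₀, hw₀, rfl⟩ := mem_allWords_cons.1 hw
    cases hfl with
    | @cons a l' u w₀' hll' hrest =>
      -- data for the outer parts
      have hT' : ∀ e ∈ T \ p.R, ∃ p' ∈ ps, e ∈ p'.R := by
        intro e he
        rw [Finset.mem_sdiff] at he
        obtain ⟨p'', hp'', hep⟩ := hT e he.1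
        rcases List.mem_cons.1 hp'' with rfl | hp''
        · exact absurd hep he.2
        · exact ⟨p'', hp'', hep⟩
      have hPT : T ∩ p.R ⊆ T := Finset.inter_subset_left
      have hT'T : T \ p.R ⊆ T := Finset.sdiff_subset
      have hsec : ∀ X ⊆ T ∩ p.R, ∀ ⦃A B : Finset (Sym2 V)⦄, A ⊆ B → B ⊆ T \ p.R → g (X ∪ A) ≤ g (X ∪ B) :=
        fun X hX A B hAB hB => hg (Finset.union_subset_union le_rfl hAB)
          (Finset.union_subset (hX.trans hPT) (hB.trans hT'T))
      -- the two sections: before and after the flips of the outer letters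
      have hFF' : ∀ X ⊆ T ∩ p.R, fiberSum q ps (T \ p.R) (fun Y => g (X ∪ Y)) w₀ ≤
          fiberSum q ps (T \ p.R) (fun Y => g (X ∪ Y)) w₀' := fun X hX =>
        ih (T \ p.R) (fun Y => g (X ∪ Y)) w₀ w₀' hpw.of_cons (fun p' hp' => hU p' (List.mem_cons_of_mem _ hp')) hT'
          (hsec X hX) hw₀ hrest
      have hF'mono : ∀ ⦃A B : Finset (Sym2 V)⦄, A ⊆ B → B ⊆ T ∩ p.R →
          fiberSum q ps (T \ p.R) (fun Y => g (A ∪ Y)) w₀' ≤ fiberSum q ps (T \ p.R) (fun Y => g (B ∪ Y)) w₀' := by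
        intro A B hAB hB
        refine fiberSum_mono hq.le ps (fun Y hY => ?_) w₀'
        exact hg (Finset.union_subset_union hAB le_rfl) (Finset.union_subset (hB.trans hPT) (hY.trans hT'T))
      rw [fiberSum_cons q hd, fiberSum_cons q hd]
      -- (i) termwise in the outer parts
      have step1 : ∑ X ∈ (T ∩ p.R).powerset.filter (fun X => p.letter (T ∩ p.R) X = (p.kind, b, bb)),
          q ^ apExp (T ∩ p.R) X * fiberSum q ps (T \ p.R) (fun Y => g (X ∪ Y)) w₀ ≤
          ∑ X ∈ (T ∩ p.R).powerset.filter (fun X => p.letter (T ∩ p.R) X = (p.kind, b, bb)),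
          q ^ apExp (T ∩ p.R) X * fiberSum q ps (T \ p.R) (fun Y => g (X ∪ Y)) w₀' := by
        refine Finset.sum_le_sum fun X hX => ?_
        have hXP : X ⊆ T ∩ p.R := Finset.mem_powerset.1 (Finset.mem_filter.1 hX).1
        exact mul_le_mul_of_nonneg_left (hFF' X hXP) (pow_nonneg hq.le _)
      refine step1.trans ?_
      -- (ii) the innermost letter: unflipped, or one application of Theorem U
      rcases hll' with rfl | ⟨hl2, rfl⟩
      · exact le_rfl
      · simp only [Prod.mk.injEq] at hl2
        obtain ⟨rfl, rfl⟩ := hl2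
        rw [← sub_nonneg, ← apUpc_eq_filter_sub q p Finset.inter_subset_right]
        exact apUpc_nonneg_of_isTTSP hq (hU p List.mem_cons_self) (T ∩ p.R) Finset.inter_subset_right _ hF'mono

end Flip

end FK

end Summit.CriticalPhenomena.PercolationContinuityZ3.Theorems

end
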